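import Mathlib
import HarnessLib
import Summits.HubbardSuperconductivity.HubbardSuperconductivity.Theses.FluxSpectroscopy
import Literature.MathematicalPhysics.QuantumLattice.HubbardTorusFlux
import Literature.MathematicalPhysics.QuantumLattice.HubbardKleinBottleFlux
import Literature.MathematicalPhysics.QuantumLattice.FockMapOpD4

/-!
# Line `birth` — BC3 skeleton for the crux `KleinSelection` (stmt-HubbardSuperconductivity-1819)

Route `FluxSpectroscopy` (route-HubbardSuperconductivity-FluxSpectroscopy), crux (rank 4)
`KleinSelection`: for all `U > 0`, `δ ∈ (0,1/2)`,
`FC_T(U,δ) → FC_K(U,δ) → (every admissible torus ground-state sequence has Yang ODLRO in eigenpair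
form, "Macro") → every admissible sequence has, eventually in even `L`, a unit eigenvector `v` of
`ρ₂(ψ_L)` with eigenvalue `≥ c N_L` which is ODD under the diagonal mirror,
`d4Act (DihedralGroup.sr 3) v = -v`.

THE LINE ("channel by topology, energies only", made honest about WHERE each difficulty sits).
A proof of `KleinSelection` has to do three logically independent things, and the skeleton names
exactly these three as stubs:

* `stub_mirrorDefiniteGroundStates` (S0, structural / spectral, about the TORUS Hamiltonian only):
  in a flux window (`FC_T ∧ FC_K`, with ODLRO available as a hypothesis) every `(N_L, S^z = 0)`-sector
  ground state `φ` of `hubbardTorus 2 L 1 U` is, eventually in even `L`, an eigenvector of the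
  second-quantised diagonal mirror `Γ(σ_d) = fockMapOp (d4Orb (DihedralGroup.sr 3))`:
  `Γ(σ_d) φ = φ ∨ Γ(σ_d) φ = -φ` (equivalently: `Γ(σ_d)` is a scalar `±1` on the sector ground
  space). This is (essentially) NECESSARY for the crux as typed: for a mirror-breaking `ψ_L` inside
  a degenerate ground multiplet `ρ₂(ψ_L) = A + B` with `B` mirror-odd `≠ 0`, and an exactly
  parity-definite exact eigenvector is non-generic — the standing refuter objection on the item
  (evidence `FluxSpectroscopy_KleinSelection_objection.md`, refuter 0860cd9d) lives PRECISELY in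
  this stub and nowhere else. If S0 dies, the crux must be re-typed (quantitative oddness), as the
  objection proposes; if S0 holds in the window, the objection is void there.
* `stub_paritySplitting` (S1, TRUE linear algebra, M/L-sized Lean): mirror-definite ground states
  + Macro ⇒ eventually a unit TOP eigenvector of `ρ₂(ψ_L)` (Rayleigh-maximal), with eigenvalue
  `≥ c N_L`, of DEFINITE mirror parity `d4Act σ_d v = ± v`. Mechanism: `Γ(σ_d) ψ_L = ± ψ_L` ⇒
  `ρ₂(ψ_L)` commutes with the pair-space mirror `d4Act σ_d` (covariance of `twoParticleRDM` under
  `fockMapOp`, `fockMapOp_mul_creation` / `fockMapOp_mul_annihilation`, `d4Orb_mul_holds`); the top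
  eigenspace of the Hermitian PSD matrix `ρ₂` (`twoParticleRDM_posSemidef`) is mirror-invariant and
  the mirror is an involution on it, so it contains a parity-definite unit vector; its eigenvalue is
  `λ_max ≥ ev ≥ c N_L`.
* `stub_evenChannelExclusion` (S2, the PHYSICS of the line — torus ↔ Klein-bottle transfer, XL):
  under `FC_T ∧ FC_K` no admissible torus ground-state sequence has, frequently in even `L`, a
  mirror-EVEN top macroscopic eigenvector of `ρ₂(ψ_L)`: a dominant condensate that is even under
  `x ↔ y` descends to the diagonal-glide Klein bottle `K_L` as a section of the TRIVIAL bundle, is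
  unfrustrated at zero flux and frustrated at `θ = π/2`, so `E^K_L(0) ≤ E^K_L(π/2) + o(1)` —
  contradicting the Klein half-flux preference `FC_K` (the lattice Geshkenbein–Larkin–Barone /
  Sigrist–Rice / tricrystal argument, with the grain boundary replaced by topology). Stated with the
  SERVED objects `fluxEnergy` (`HubbardTorusFlux.lean`, the route's inline `E^T` by `rfl`) and
  `kleinBottleFluxEnergy` (`HubbardKleinBottleFlux.lean`, `= E^K` by `hubbardKleinBottleFlux_eq_inline`).

Composition `KleinSelection_of : KleinSelection` (sorry-free, the ONLY theorem of this file whose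
head is the crux name, as `ledger skeleton check` requires; the stubs enter BY NAME because the
skeleton audit admits no inline-signature hypotheses): bridge the crux's inline `FC_T`/`FC_K` to
the named envelopes (`rfl` resp. `kleinBottleFluxEnergy_eq_inline` below), get mirror-definite
ground states from S0, a parity-definite top macroscopic eigenvector from S1, and exclude the even
alternative with S2 along the same `∀ᶠ L` filter. `sorry` occurs ONLY in the three `stub_*` theorems.

Disproof used: none on record (no `Cruxes/KleinSelection/Disproof.lean`, no landed
`Theorems/KleinSelection/Negative/*` at registration time); negatives index of the summit checked:
no refuted statement of this shape (mirror parity of sector ground states / ρ₂-eigenvectors).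
-/

-- `Summit.<Summit>.<Problem>`: for the single-conjunct summit the duplicate component is mandated.
set_option linter.dupNamespace false
set_option linter.unusedVariables false

namespace Summit.HubbardSuperconductivity.HubbardSuperconductivity.Cruxes.KleinSelection.Birth

open Filter
open Literature.Hubbard
open Literature.MathematicalPhysics.QuantumLattice
open Summit.HubbardSuperconductivity.HubbardSuperconductivity.Theses.FluxSpectroscopy

/-! ## The three registered stubs -/

/-- **Stub S0 — mirror-definite sector ground states in a flux window** (structural; carries the
standing objection). For all `U > 0`, `δ ∈ (0,1/2)`: if the torus flux criterion `FC_T(U,δ)`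
(O(1) pair stiffness of the sector minimum `fluxEnergy` up to half a pair flux quantum) and the
Klein half-flux preference `FC_K(U,δ)` (`kleinBottleFluxEnergy` lower at `θ = π/2` than at `0` by
`κ > 0`) hold, and every admissible ground-state sequence has Yang ODLRO (eigenpair form), then
eventually in even `L` EVERY `(N_L, S^z=0)`-sector ground state `φ` of `hubbardTorus 2 L 1 U`,
`N_L = 2⌊(1-δ)L²/2⌋`, is an eigenvector of the second-quantised diagonal mirror
`Γ(σ_d) = fockMapOp (d4Orb (DihedralGroup.sr 3))` (`σ_d : (a,b) ↦ (b,a)`; `Γ(σ_d)² = 1` by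
`fockMapOp_d4Orb_mul`, `fockMapOp_d4Orb_one`, so the eigenvalue is `±1`). Equivalently the sector
ground space has a definite mirror parity (a stiff single-channel condensate has a ground multiplet
inside one `D₄`-isotypic component on which `σ_d` is scalar; for a unique ground state it is
automatic from `IsGroundStateInSector.fockMapOp_d4Orb_mulVec`). Why it might fail: persistent
(for infinitely many even `L`) ground-state degeneracies across mirror parities — open shells,
ground momentum `P` with `σ_d P ≠ ±P`, a two-dimensional irrep `E` — in a window where `FC_T ∧ FC_K`
nevertheless hold; this is exactly the refuter's basis-choice objection to the crux, isolated.
Size: L (no theorem controls ground-state quantum numbers of the doped repulsive Hubbard torus;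
Lieb-type uniqueness needs `U < 0` or half filling). Sources: Lieb1989 (spin/uniqueness by
reflection positivity — the template, not applicable at `U > 0` off half filling), Scalapino1995 §2,
TsueiKirtley2000 §IV, refuter objection file on stmt-1819. -/
theorem stub_mirrorDefiniteGroundStates :
    ∀ U δ : ℝ, 0 < U → δ ∈ Set.Ioo (0 : ℝ) (1 / 2) →
      (∃ ρ : ℝ, 0 < ρ ∧ ∀ᶠ L : ℕ in Filter.atTop, ∀ [NeZero L], Even L → ∀ θ : ℝ,
          |θ| ≤ Real.pi / 2 → ρ * θ ^ 2 ≤ fluxEnergy L U δ θ - fluxEnergy L U δ 0) →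
      (∃ κ : ℝ, 0 < κ ∧ ∀ᶠ L : ℕ in Filter.atTop, ∀ [NeZero L], Even L →
          κ ≤ kleinBottleFluxEnergy L U δ 0 - kleinBottleFluxEnergy L U δ (Real.pi / 2)) →
      (∀ (N : ℕ → ℕ) (ψ : ∀ L : ℕ, Fock (Orb (FermionTorus 2 L))),
          (∀ L, Even L → N L = 2 * ⌊(1 - δ) * (L : ℝ) ^ 2 / 2⌋₊ ∧ star (ψ L) ⬝ᵥ ψ L = 1 ∧
              IsGroundStateInSector (hubbardTorus 2 L 1 U) (N L) 0 (ψ L)) →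
            ∃ c : ℝ, 0 < c ∧ ∀ᶠ L : ℕ in Filter.atTop, ∀ [NeZero L], Even L →
              ∃ v : Orb (FermionTorus 2 L) × Orb (FermionTorus 2 L) → ℂ, ∃ ev : ℝ,
                star v ⬝ᵥ v = 1 ∧ Matrix.mulVec (twoParticleRDM (ψ L)) v = (ev : ℂ) • v ∧
                  c * (N L : ℝ) ≤ ev) →
      ∀ᶠ L : ℕ in Filter.atTop, ∀ [NeZero L], Even L →
        ∀ φ : Fock (Orb (FermionTorus 2 L)),
          IsGroundStateInSector (hubbardTorus 2 L 1 U) (2 * ⌊(1 - δ) * (L : ℝ) ^ 2 / 2⌋₊) 0 φ →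
            Matrix.mulVec (fockMapOp (d4Orb (DihedralGroup.sr 3))) φ = φ ∨
              Matrix.mulVec (fockMapOp (d4Orb (DihedralGroup.sr 3))) φ = -φ := by
  sorry

/-- **Stub S1 — parity splitting of the condensate** (TRUE linear algebra; provable now). For every
`U, δ` and every admissible sequence `ψ` (normalised `(N_L,0)`-sector ground states along even `L`):
if eventually every sector ground state is a `Γ(σ_d)`-eigenvector (S0's conclusion) and `ψ` has a
macroscopic `ρ₂`-eigenpair eventually (Macro, constant `c`), then eventually in even `L` there is a
unit vector `v` which is a TOP eigenvector of `ρ₂(ψ_L) = twoParticleRDM (ψ L)` (eigenvalue `ev`,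
Rayleigh-maximal: `re ⟨w, ρ₂ w⟩ ≤ ev` for all unit `w`), with `ev ≥ c N_L` (same `c`), and of
DEFINITE diagonal-mirror parity `d4Act σ_d v = v ∨ d4Act σ_d v = -v`. Proof sketch:
`Γ(σ_d) ψ_L = ± ψ_L` and the covariance `ρ₂(Γ(γ)ψ)(p,q) = ρ₂(ψ)(γ⁻¹p, γ⁻¹q)` (from
`fockMapOp_mul_creation`/`fockMapOp_mul_annihilation`, `conjTranspose_fockMapOp_d4Orb`, unitarity)
give `ρ₂(ψ_L) ∘ (σ_d × σ_d) = ρ₂(ψ_L)`, i.e. `ρ₂` commutes with the involutive permutation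
`d4Act σ_d` of pair space (`d4Act_mul d4Orb_mul_holds`, `(sr 3)*(sr 3) = 1`); `ρ₂` is Hermitian PSD
(`twoParticleRDM_posSemidef`), its top eigenvalue `λ_max ≥ ev_Macro ≥ c N_L`, the top eigenspace is
`d4Act σ_d`-invariant, hence splits into `±1`-eigenspaces of the involution, one of them non-zero:
normalise a vector there. Why it might fail: it does not (modulo typos); the risk of the line is in
S0 and S2. Size: M/L (ρ₂-covariance under `fockMapOp` is not yet in the tree; spectral theorem via
`Matrix.IsHermitian.eigenvectorBasis`). Sources: Yang1962 §4, Scalapino1995 §2, PenroseOnsager1956. -/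
theorem stub_paritySplitting :
    ∀ (U δ : ℝ) (N : ℕ → ℕ) (ψ : ∀ L : ℕ, Fock (Orb (FermionTorus 2 L))),
      (∀ L, Even L → N L = 2 * ⌊(1 - δ) * (L : ℝ) ^ 2 / 2⌋₊ ∧ star (ψ L) ⬝ᵥ ψ L = 1 ∧
          IsGroundStateInSector (hubbardTorus 2 L 1 U) (N L) 0 (ψ L)) →
      (∀ᶠ L : ℕ in Filter.atTop, ∀ [NeZero L], Even L →
          ∀ φ : Fock (Orb (FermionTorus 2 L)),
            IsGroundStateInSector (hubbardTorus 2 L 1 U) (2 * ⌊(1 - δ) * (L : ℝ) ^ 2 / 2⌋₊) 0 φ →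
              Matrix.mulVec (fockMapOp (d4Orb (DihedralGroup.sr 3))) φ = φ ∨
                Matrix.mulVec (fockMapOp (d4Orb (DihedralGroup.sr 3))) φ = -φ) →
      (∃ c : ℝ, 0 < c ∧ ∀ᶠ L : ℕ in Filter.atTop, ∀ [NeZero L], Even L →
          ∃ v : Orb (FermionTorus 2 L) × Orb (FermionTorus 2 L) → ℂ, ∃ ev : ℝ,
            star v ⬝ᵥ v = 1 ∧ Matrix.mulVec (twoParticleRDM (ψ L)) v = (ev : ℂ) • v ∧
              c * (N L : ℝ) ≤ ev) →
      ∃ c : ℝ, 0 < c ∧ ∀ᶠ L : ℕ in Filter.atTop, ∀ [NeZero L], Even L →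
        ∃ v : Orb (FermionTorus 2 L) × Orb (FermionTorus 2 L) → ℂ, ∃ ev : ℝ,
          star v ⬝ᵥ v = 1 ∧ Matrix.mulVec (twoParticleRDM (ψ L)) v = (ev : ℂ) • v ∧
            c * (N L : ℝ) ≤ ev ∧
            (∀ w : Orb (FermionTorus 2 L) × Orb (FermionTorus 2 L) → ℂ, star w ⬝ᵥ w = 1 →
                (star w ⬝ᵥ Matrix.mulVec (twoParticleRDM (ψ L)) w).re ≤ ev) ∧
            (d4Act (DihedralGroup.sr 3) v = v ∨ d4Act (DihedralGroup.sr 3) v = -v) := by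
  sorry

/-- **Stub S2 — the Klein bottle excludes an even dominant channel** (the physics of the line;
torus ↔ Klein-bottle transfer, energies only). For all `U > 0`, `δ ∈ (0,1/2)` with `FC_T(U,δ)` and
`FC_K(U,δ)`, every admissible sequence `ψ` and every `c > 0`: eventually in even `L`, NO unit top
eigenvector `v` of `ρ₂(ψ_L)` (Rayleigh-maximal, eigenvalue `ev ≥ c N_L`) is EVEN under the
diagonal mirror, `d4Act σ_d v ≠ v`. Heuristic (to be made a proof): a dominant condensate with pair
wavefunction even under `x ↔ y` (channels `A1g ⊕ B2g`: `s`, extended `s`, `d_{xy}`) descends from the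
torus to the diagonal-glide Klein bottle `K_L` as a section of the TRIVIAL `ℤ₂`-bundle (the glide
swaps `x`- and `y`-bonds, `dWaveFormFactor_swap` is the odd case), so by local indistinguishability
of torus and Klein-bottle bulk states plus the stiffness `FC_T` one gets the variational comparison
`E^K_L(0) ≤ E^K_L(π/2) + o(1)` (unfrustrated at zero flux, frustrated by `≈ ρ_s π²/2 > 0` at half a
superconducting flux quantum) — incompatible with `FC_K`: `E^K_L(0) - E^K_L(π/2) ≥ κ > 0`. Stated
over the served envelopes `fluxEnergy` / `kleinBottleFluxEnergy`. Why it might fail: it is a bulk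
transfer between boundary conditions for a GAPLESS (nodal) interacting state, backed by no theorem
(`HasLTQO`-type indistinguishability is for gapped frustration-free systems); a first-order
coexistence at `(U,δ)` could let torus and Klein bottle realise different bulk states; a fragmented
condensate whose density-dominant and stiffness-dominant channels differ. Size: XL (the analytic
heart of the route together with `FluxWindow`). Sources: GeshkenbeinLarkinBarone1987,
SigristRice1992, TsueiKirtley2000 §IV, KronfeldWiese1991 (C-periodic b.c.), XiangWu2022 §6.2–6.3,
ByersYang1961, arXiv:2601.18868. -/
theorem stub_evenChannelExclusion :
    ∀ U δ : ℝ, 0 < U → δ ∈ Set.Ioo (0 : ℝ) (1 / 2) →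
      (∃ ρ : ℝ, 0 < ρ ∧ ∀ᶠ L : ℕ in Filter.atTop, ∀ [NeZero L], Even L → ∀ θ : ℝ,
          |θ| ≤ Real.pi / 2 → ρ * θ ^ 2 ≤ fluxEnergy L U δ θ - fluxEnergy L U δ 0) →
      (∃ κ : ℝ, 0 < κ ∧ ∀ᶠ L : ℕ in Filter.atTop, ∀ [NeZero L], Even L →
          κ ≤ kleinBottleFluxEnergy L U δ 0 - kleinBottleFluxEnergy L U δ (Real.pi / 2)) →
      ∀ (N : ℕ → ℕ) (ψ : ∀ L : ℕ, Fock (Orb (FermionTorus 2 L))),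
        (∀ L, Even L → N L = 2 * ⌊(1 - δ) * (L : ℝ) ^ 2 / 2⌋₊ ∧ star (ψ L) ⬝ᵥ ψ L = 1 ∧
            IsGroundStateInSector (hubbardTorus 2 L 1 U) (N L) 0 (ψ L)) →
        ∀ c : ℝ, 0 < c → ∀ᶠ L : ℕ in Filter.atTop, ∀ [NeZero L], Even L →
          ∀ (v : Orb (FermionTorus 2 L) × Orb (FermionTorus 2 L) → ℂ) (ev : ℝ),
            star v ⬝ᵥ v = 1 → Matrix.mulVec (twoParticleRDM (ψ L)) v = (ev : ℂ) • v →
              c * (N L : ℝ) ≤ ev →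
              (∀ w : Orb (FermionTorus 2 L) × Orb (FermionTorus 2 L) → ℂ, star w ⬝ᵥ w = 1 →
                  (star w ⬝ᵥ Matrix.mulVec (twoParticleRDM (ψ L)) w).re ≤ ev) →
                d4Act (DihedralGroup.sr 3) v ≠ v := by
  sorry

/-! ## Sorry-free infrastructure: the route's inline envelopes are the served ones -/

/-- The route's inline torus envelope `E^T_L(U,δ;θ)` IS `fluxEnergy L U δ θ` (definitional:
`fluxEnergy`/`hubbardTorusFlux` unfold to the literal `hubbardTorus 2 L 1 U + Σ (1 - e^{±iθ}) c†c`
term of `Theses/FluxSpectroscopy.lean`). [folklore] -/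
theorem fluxEnergy_eq_inline (L : ℕ) [NeZero L] (U δ θ : ℝ) :
    fluxEnergy L U δ θ =
      (hubbardTorus 2 L 1 U + ∑ y : ZMod L, ∑ σ : Fin 2, ∑ b : Bool,
          (1 - Complex.exp ((if b then 1 else -1) * Complex.I * θ)) •
            (creation (orb (FermionTorus.ofTorusSite ![if b then 0 else -1, y]) σ) *
              annihilation (orb (FermionTorus.ofTorusSite ![if b then -1 else 0, y]) σ))).minEnergyOn
        (szSector (2 * ⌊(1 - δ) * (L : ℝ) ^ 2 / 2⌋₊) 0) :=
  rfl

/-- The route's inline Klein-bottle envelope `E^K_L(U,δ;θ)` is `kleinBottleFluxEnergy L U δ θ`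
(by `hubbardKleinBottleFlux_eq_inline`: the `fromRel` graph is `kleinBottleGraph L` by `rfl` and the
`Bool`-indexed seam sum is `(1 - e^{iθ}) J + (1 - e^{-iθ}) Jᴴ`). [folklore] -/
theorem kleinBottleFluxEnergy_eq_inline (L : ℕ) [NeZero L] (U δ θ : ℝ) :
    kleinBottleFluxEnergy L U δ θ =
      (hamiltonian (SimpleGraph.fromRel fun p q : Lex (Fin (2 * L) × Fin L) =>
            ((ofLex p).1.val + 1 = (ofLex q).1.val ∧
                ((ofLex q).2 = (ofLex p).2 ∨ (ofLex q).2 = (ofLex p).2 - 1)) ∨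
              ((ofLex p).1.val + 1 = 2 * L ∧ (ofLex q).1.val = 0 ∧
                ((ofLex q).2 = -(ofLex p).2 ∨ (ofLex q).2 = -(ofLex p).2 + 1))) 1 U +
          ∑ p : Lex (Fin (2 * L) × Fin L), ∑ q : Lex (Fin (2 * L) × Fin L), ∑ σ : Fin 2, ∑ b : Bool,
            (if ((ofLex p).1.val + 1 = 2 * L ∧ (ofLex q).1.val = 0 ∧
                  ((ofLex q).2 = -(ofLex p).2 ∨ (ofLex q).2 = -(ofLex p).2 + 1)) then
                (1 - Complex.exp ((if b then 1 else -1) * Complex.I * θ)) •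
                  (creation (orb (if b then q else p) σ) * annihilation (orb (if b then p else q) σ))
              else 0)).minEnergyOn
        (szSector (2 * ⌊(1 - δ) * (L : ℝ) ^ 2⌋₊) 0) := by
  rw [kleinBottleFluxEnergy, hubbardKleinBottleFlux_eq_inline]

/-! ## The composition: the three stubs prove the crux BY NAME -/

/-- **THE SKELETON THEOREM.** The crux
`Summit.HubbardSuperconductivity.HubbardSuperconductivity.Theses.FluxSpectroscopy.KleinSelection`,
concluded BY NAME from the three DECLARED stubs `stub_mirrorDefiniteGroundStates` (S0),
`stub_paritySplitting` (S1) and `stub_evenChannelExclusion` (S2) — the only `sorry`s of this file.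
Real composition (no `sorry`, standard axioms apart from the stubs' `sorryAx`): the crux's inline
`FC_T` is the named one by `rfl`, its inline `FC_K` is transported along
`kleinBottleFluxEnergy_eq_inline`; S0 gives mirror-definite sector ground states eventually, S1 a
parity-definite TOP macroscopic eigenvector of `ρ₂(ψ_L)` eventually (constant `c`), S2 at that `c`
forbids the even parity eventually; intersecting the two `atTop`-eventualities leaves the odd case,
which is the crux's conclusion `MacroOdd`. Every hypothesis of the crux is consumed (`FC_T`, `FC_K`
by S0 and S2, the ODLRO hypothesis by S0 and — specialised to the sequence at hand — by S1). [folklore] -/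
theorem KleinSelection_of :
    Summit.HubbardSuperconductivity.HubbardSuperconductivity.Theses.FluxSpectroscopy.KleinSelection :=
  fun U δ hU hδ hT hK hM N ψ hyp => by
    -- (1) the inline torus flux criterion is the named one (definitional; `rw` only for the record)
    have hT' : ∃ ρ : ℝ, 0 < ρ ∧ ∀ᶠ L : ℕ in Filter.atTop, ∀ [NeZero L], Even L → ∀ θ : ℝ,
        |θ| ≤ Real.pi / 2 → ρ * θ ^ 2 ≤ fluxEnergy L U δ θ - fluxEnergy L U δ 0 := by
      obtain ⟨ρ, hρ, hev⟩ := hT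
      refine ⟨ρ, hρ, hev.mono fun L hL => ?_⟩
      intro inst hLe θ hθ
      rw [fluxEnergy_eq_inline, fluxEnergy_eq_inline]
      exact hL hLe θ hθ
    -- (2) the inline Klein-bottle half-flux preference is the named one (propositional bridge)
    have hK' : ∃ κ : ℝ, 0 < κ ∧ ∀ᶠ L : ℕ in Filter.atTop, ∀ [NeZero L], Even L →
        κ ≤ kleinBottleFluxEnergy L U δ 0 - kleinBottleFluxEnergy L U δ (Real.pi / 2) := by
      obtain ⟨κ, hκ, hev⟩ := hK
      refine ⟨κ, hκ, hev.mono fun L hL => ?_⟩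
      intro inst hLe
      rw [kleinBottleFluxEnergy_eq_inline, kleinBottleFluxEnergy_eq_inline]
      exact hL hLe
    -- (3) S0: in the window, sector ground states are mirror-definite, eventually in even L
    have h0 := stub_mirrorDefiniteGroundStates U δ hU hδ hT' hK' hM
    -- (4) S1: a parity-definite top macroscopic eigenvector of ρ₂(ψ_L), eventually
    obtain ⟨c, hc, h1⟩ := stub_paritySplitting U δ N ψ hyp h0 (hM N ψ hyp)
    -- (5) S2: at this `c`, no even top macroscopic eigenvector, eventually
    have h2 := stub_evenChannelExclusion U δ hU hδ hT' hK' N ψ hyp c hc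
    -- (6) intersect the two eventualities: the parity-definite top eigenvector is odd
    refine ⟨c, hc, ?_⟩
    filter_upwards [h1, h2] with L h1L h2L
    intro inst hLe
    obtain ⟨v, ev, hv1, hev, hcN, htop, hpar⟩ := h1L hLe
    rcases hpar with heven | hodd
    · exact absurd heven (h2L hLe v ev hv1 hev hcN htop)
    · exact ⟨v, ev, hv1, hev, hcN, hodd⟩

end Summit.HubbardSuperconductivity.HubbardSuperconductivity.Cruxes.KleinSelection.Birth
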